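import Mathlib
import Summits.Ventures.PercRepro.TriangleCapRowA1Last
import Summits.Ventures.PercRepro.TriangleCapRowA1Arith6

/-!
# PercRepro — THE ROW `r = a + 1`: THE LAST MIXED CASE `d = a − 1` FOR EVERY `a ≥ 6` (p3, gen 47; part 200za)

`rowA1_last_mixed` of part 200v′ (`a ≥ 8`) re-assembled with the arithmetic of part 200z (`a ≥ 6`): the proof is the
same — the other bipartition of `D − z` is not a star (the stability `2 (a − 2)`, exact) or a star at a vertex `v`;
with `s₀ ≥ 2` off-side neighbours of `z` each has degree `≤ a + 1 − t` in `D − z`, and with a single one, `w₀`, it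
misses `≥ t − 1 ≥ 2` in-side neighbours of `z`, is the centre `v`, and is isolated in `D − z`. Axioms: standard.
-/

namespace PercRepro

namespace TriangleCap

namespace C047

open Finset

variable {V : Type*} [Fintype V] [DecidableEq V]

/-- **THE LAST MIXED CASE OF THE ROW `r = a + 1`:** `d(z) = a − 1`, `D − z ⊆ K(A′, A′ᶜ)` with `a` missing pairs, a
neighbour of `z` off the side and one on it ⇒ `Σ_v d(v)² + (a + 1)(k − 1 − (a + 1)) + (2k − 10) ≤ m k`. -/
theorem rowA1_last_mixed' (D : SimpleGraph V) [DecidableRel D.Adj] (hK : K4mFree D) (a : ℕ) (ha6 : 6 ≤ a)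
    (hk : 3 * a + 1 ≤ Fintype.card V) (hm : D.edgeFinset.card + (a + 1) = a * (Fintype.card V - a)) (z : V)
    (hz : deg D z = a - 1) (A' : Finset {v : V // v ≠ z}) (hA'card : A'.card = a) (hB : BipSub (del D z) A')
    (hm' : (del D z).edgeFinset.card + a = a * (Fintype.card {v : V // v ≠ z} - a))
    (hcap : ∀ v, deg D v ≤ (Fintype.card V - a - 2) + 1) (w₀ : {v : V // v ≠ z}) (hw₀A : w₀ ∉ A')
    (hw₀z : D.Adj w₀.1 z) (w₁ : {v : V // v ≠ z}) (hw₁A : w₁ ∈ A') (hw₁z : D.Adj w₁.1 z) :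
    ∑ v, deg D v * deg D v + (a + 1) * (Fintype.card V - 1 - (a + 1)) + (2 * Fintype.card V - 10) ≤
      D.edgeFinset.card * Fintype.card V := by
  have hcard' := card_del z
  have hedges' := card_edges_del D z
  have hsq := sum_deg_sq_del D z
  obtain ⟨Nz, hNzdef⟩ : ∃ Nz : Finset {v : V // v ≠ z},
      Nz = univ.filter (fun w : {v : V // v ≠ z} => D.Adj w.1 z) := ⟨_, rfl⟩
  have hmemNz : ∀ w : {v : V // v ≠ z}, w ∈ Nz ↔ D.Adj w.1 z := fun w => by
    rw [hNzdef, mem_filter]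
    simp only [mem_univ, true_and]
  have hNz : Nz.card = deg D z := by rw [hNzdef]; exact card_nbhd_del D z
  have hTfilt : ∑ w : {v : V // v ≠ z}, (if D.Adj w.1 z then deg (del D z) w else 0) =
      ∑ w ∈ Nz, deg (del D z) w := by
    rw [hNzdef, sum_filter]
  rw [hTfilt] at hsq
  obtain ⟨T, hTdef⟩ : ∃ T, ∑ w ∈ Nz, deg (del D z) w = T := ⟨_, rfl⟩
  obtain ⟨S', hS'def⟩ : ∃ S', ∑ w : {v : V // v ≠ z}, deg (del D z) w * deg (del D z) w = S' := ⟨_, rfl⟩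
  obtain ⟨m', hm'def⟩ : ∃ m', (del D z).edgeFinset.card = m' := ⟨_, rfl⟩
  rw [hTdef, hS'def] at hsq
  rw [hm'def] at hedges'
  have hcardV' : Fintype.card {v : V // v ≠ z} = Fintype.card V - 1 := by omega
  have hmd : m' + (a - 1) + (a + 1) = a * (Fintype.card V - a) := by omega
  have hdegNz : ∀ w ∈ Nz, deg (del D z) w + 1 ≤ Fintype.card V - a - 1 := fun w hw => by
    have h := deg_del D z w
    rw [if_pos ((hmemNz w).mp hw)] at h
    have := hcap w.1
    omega
  rw [hsq, ← hedges', hz]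
  by_cases hstar : ∃ v, MissingStar (del D z) A' v
  · -- THE STAR CASE
    obtain ⟨v, hv⟩ := hstar
    have hS := sum_deg_sq_le_of_bipSub (del D z) A' hB a a hA'card hm' (by omega)
    rw [hS'def, hm'def, hcardV'] at hS
    -- the in-side and off-side neighbours of `z`
    obtain ⟨I, hI⟩ : ∃ I : Finset {v : V // v ≠ z}, I = Nz.filter (fun w => w ∈ A') := ⟨_, rfl⟩
    obtain ⟨O, hO⟩ : ∃ O : Finset {v : V // v ≠ z}, O = Nz.filter (fun w => w ∉ A') := ⟨_, rfl⟩
    have hIO : I.card + O.card = deg D z := by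
      rw [hI, hO, card_filter_add_card_filter_not, hNz]
    have hIeq : I = A'.filter (fun w => D.Adj w.1 z) := by
      rw [hI]
      ext w
      rw [mem_filter, mem_filter, hmemNz]
      tauto
    have hTsplit : T = ∑ w ∈ I, deg (del D z) w + ∑ w ∈ O, deg (del D z) w := by
      rw [← hTdef, hI, hO, sum_filter_add_sum_filter_not]
    have hTI : ∑ w ∈ I, deg (del D z) w ≤ I.card * (Fintype.card V - a - 2) := by
      rw [← smul_eq_mul, ← sum_const]
      apply sum_le_sum
      intro w hw
      have := hdegNz w (mem_of_mem_filter w (hI ▸ hw))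
      omega
    have hoff : ∀ w ∈ O, deg (del D z) w + I.card ≤ a + 1 := fun w hw => by
      rw [hO, mem_filter, hmemNz] at hw
      have h := offside_deg_bound D hK z A' hB w hw.2 hw.1
      rw [← hIeq, hA'card] at h
      exact h
    have hTO : ∑ w ∈ O, deg (del D z) w ≤ O.card * (a + 1 - I.card) := by
      rw [← smul_eq_mul, ← sum_const]
      apply sum_le_sum
      intro w hw
      have := hoff w hw
      omega
    have hw₀O : w₀ ∈ O := by rw [hO, mem_filter, hmemNz]; exact ⟨hw₀z, hw₀A⟩
    have hw₁I : w₁ ∈ I := by rw [hI, mem_filter, hmemNz]; exact ⟨hw₁z, hw₁A⟩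
    have hO1 : 1 ≤ O.card := card_pos.mpr ⟨w₀, hw₀O⟩
    have hI1 : 1 ≤ I.card := card_pos.mpr ⟨w₁, hw₁I⟩
    rcases Nat.lt_or_ge O.card 2 with hO2 | hO2
    · -- a single off-side neighbour: it misses two in-side neighbours of `z`, so it is the centre, isolated in `D − z`
      have hOcard : O.card = 1 := by omega
      have hOeq : O = {w₀} := by
        apply (eq_singleton_iff_unique_mem).mpr ⟨hw₀O, fun w hw => ?_⟩
        have := card_le_one.mp (by omega : O.card ≤ 1) w hw w₀ hw₀O
        exact this
      have hIcard : I.card = a - 2 := by omega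
      -- the in-side neighbours adjacent to `w₀`: at most one
      have hone : (I.filter (fun w => (del D z).Adj w₀ w)).card ≤ 1 := by
        by_contra hcon
        push Not at hcon
        obtain ⟨x₁, hx₁, x₂, hx₂, hne⟩ := one_lt_card.mp hcon
        rw [mem_filter] at hx₁ hx₂
        have hx₁z := (hmemNz x₁).mp (mem_of_mem_filter x₁ (hI ▸ hx₁.1))
        have hx₂z := (hmemNz x₂).mp (mem_of_mem_filter x₂ (hI ▸ hx₂.1))
        exact not_adj_both D hK (D.adj_symm hw₀z) (D.adj_symm hx₁z) ((del_adj D z w₀ x₁).mp hx₁.2)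
          (fun h => hne (Subtype.ext h)) (D.adj_symm hx₂z) ((del_adj D z w₀ x₂).mp hx₂.2)
      have htwo : 1 < (I.filter (fun w => ¬ (del D z).Adj w₀ w)).card := by
        have := card_filter_add_card_filter_not (s := I) (fun w => (del D z).Adj w₀ w)
        omega
      obtain ⟨x₁, hx₁, x₂, hx₂, hne⟩ := one_lt_card.mp htwo
      rw [mem_filter] at hx₁ hx₂
      have hx₁A : x₁ ∈ A' := (mem_filter.mp (hI ▸ hx₁.1)).2
      have hx₂A : x₂ ∈ A' := (mem_filter.mp (hI ▸ hx₂.1)).2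
      -- the centre is `w₀`
      have hvw₀ : v = w₀ := by
        have h1 := hv x₁ w₀ hx₁A hw₀A (fun h => hx₁.2 ((del D z).adj_symm h))
        have h2 := hv x₂ w₀ hx₂A hw₀A (fun h => hx₂.2 ((del D z).adj_symm h))
        rcases h1 with h1 | h1
        · rcases h2 with h2 | h2
          · exact absurd (h1.trans h2.symm) hne
          · exact h2.symm
        · exact h1.symm
      subst hvw₀
      -- every missing edge contains `w₀`: its missing degree is `a`, its degree in `D − z` is `0`
      have hall : ∀ e ∈ (missingGraph (del D z) A').edgeFinset, v ∈ e := by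
        intro e he
        revert he
        refine Sym2.ind (fun x y he => ?_) e
        rw [SimpleGraph.mem_edgeFinset, SimpleGraph.mem_edgeSet, missingGraph_adj] at he
        rw [Sym2.mem_iff]
        by_cases hxA : x ∈ A'
        · have hyA : y ∉ A' := he.1.mp hxA
          rcases hv x y hxA hyA he.2 with h | h
          · exact absurd h (fun h => hw₀A (h ▸ hxA))
          · exact Or.inr h.symm
        · have hyA : y ∈ A' := by
            by_contra hyA
            exact hxA (he.1.mpr hyA)
          rcases hv y x hyA hxA (fun h => he.2 ((del D z).adj_symm h)) with h | h
          · exact absurd h (fun h => hw₀A (h ▸ hyA))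
          · exact Or.inl h.symm
      have hdegm := deg_eq_card_edges_of_forall (missingGraph (del D z) A') v hall
      rw [card_edges_missingGraph (del D z) A' hB a a hA'card hm'] at hdegm
      have hsum := deg_add_deg_missingGraph (del D z) A' hB v
      rw [if_neg hw₀A, hA'card, hdegm] at hsum
      have hdeg0 : deg (del D z) v = 0 := by omega
      have hTO' : ∑ w ∈ O, deg (del D z) w = 0 := by rw [hOeq, sum_singleton, hdeg0]
      have hT' : T ≤ (a - 2) * (Fintype.card V - a - 2) := by
        rw [hTsplit, hTO', add_zero, ← hIcard]
        exact hTI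
      exact rowA1_last_star0' a (Fintype.card V) m' S' T ha6 hk hmd hS hT'
    · -- `≥ 2` off-side neighbours, each of degree `≤ a + 1 − t`
      have hT' : T ≤ I.card * (Fintype.card V - a - 2) + O.card * (a + 1 - I.card) := by
        rw [hTsplit]
        omega
      exact rowA1_last_star_ref' a I.card O.card (Fintype.card V) m' S' T ha6 hk (by omega) hO2 hI1 hmd hS hT'
  · -- THE NON-STAR CASE: the stability of the other bipartition of `D − z`
    have hS := closed_form_stability_bipSub (del D z) A' hB a a hA'card hm' (by omega) (by omega) hstar
    rw [hS'def, hm'def, hcardV'] at hS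
    have hdw₀ : deg (del D z) w₀ ≤ a := by
      have := deg_le_card_of_bipSub (del D z) A' hB w₀ hw₀A
      rw [hA'card] at this
      exact this
    have hT' := sum_le_of_mem_le_gen Nz (fun w => deg (del D z) w) (Fintype.card V - a - 2) a
      ((hmemNz w₀).mpr hw₀z) (fun w hw => by have := hdegNz w hw; omega) hdw₀
    rw [hTdef, hNz, hz] at hT'
    exact rowA1_last_nonstar' a (Fintype.card V) m' S' T ha6 hk hmd hS hT'

end C047

end TriangleCap

end PercRepro
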